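/-
Copyright (c) 2026. All rights reserved.
Released under Apache 2.0 license as described in the file LICENSE.
-/
import Literature.AlgebraicGeometry.ComplexMultiplication.HyperellipticJacobianCMCurveSquareTimesSimpleFourfoldWeilPlane
import Literature.AlgebraicGeometry.ComplexMultiplication.EndomorphismFieldNondegenerateType
import Literature.AlgebraicGeometry.ComplexMultiplication.CMTorusProductsMumfordTateRankBounds
import Literature.AlgebraicGeometry.Pohlmann1968.CorankOneCMFamilyWeightedPowersHodgeConjecture
import HarnessLib

/-!
# `J_{40}`: THE HODGE CONJECTURE FOR EVERY `E'^a × Y_{40}^c` — the CM elliptic curve `E' = Y_8` of `ℚ(√−2)` and the simple CM fourfold `Y_{40}` —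
# IS EQUIVALENT TO THE ALGEBRAICITY OF THE ONE WEIL PLANE OF THE SIXFOLD `Z = E' ⊕ E' ⊕ Y_{40}` (Moonen–Zarhin's case (g), §5 Case 2, explicit)

Family `hodge`, cell `pub-hodgecm2` (COR-CM), KEPT Literature lane `lit-deligne-3` (generation 58, file F58c; the `J_{40}` application of F58a ∕ F58b
`Pohlmann1968/CorankOneCMFamilyWeightedPowers{Weights,HodgeConjecture}` — the multiplicity-weighted corank-one theory — on the data of F42 (`E'`, `Y_{40}`
as the simple factors of `X_8 ∼ E'²`, `X_{40} ∼ Y_{40}²`), F46 §4 (`√−2 ∈ L_{40}`), F47 (`(1,3)`), F50 (`(3,3)`), F53 (`X_8 ⊕ Y_{40}` of Weil type)).  THEOREMS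
ONLY: no definition, no named fact, no `sorry`, no instance; D-0026 net debt `0`.  The algebraicity of the Weil plane is asserted NOWHERE; HC_CM is NOT proved.

THE POINT.  Moonen–Zarhin, Math. Ann. **315** (1999): Introduction (g) and Thm. 0.2 (3) «`X ∼ E × Y` […] `k ↪ End⁰(Y)` acts on `T_{Y,0}` with
multiplicities `(1,3)` […] `B•(X) = D•(X)` but `Hg(X) ≠ Hg(E) × Hg(Y)`»; §5 Case 2 «Rather than looking at `E × Y`, let us look at `Z := E² × Y`. There is
an embedding `k ↪ End⁰(Z)` such that `k` acts on `T_{Z,0}` with multiplicities `(3,3)`. This implies that the corresponding space of Weil classes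
`W_k ⊂ H⁶(Z, ℚ)` consists of Hodge classes»; §3 (3.1) «`Hg(X₁ × X₂) ≠ Hg(X₁) × Hg(X₂)` […] iff for some `m` and `n` the Hodge ring `B•(X₁^m × X₂^n)` is
not generated by the elements coming from `B•(X₁^m)` and `B•(X₂^n)`».  Inside `J_{40} = Jac(y² = x^{40} + 1)`: `E' = Y_8` (CM by
`L_8 = ℚ(ζ_8 − ζ_8^{−1}) = ℚ(√−2)`), `Y_{40}` simple with CM by `L_{40} = ℚ(ζ_{40} − ζ_{40}^{−1}) ∋ w = ζ_{40}⁵ − ζ_{40}^{−5}` (`w² = −2`), on whose type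
`Ψ_{40}` the field `k = ℚ(√−2)` has multiplicities `(1,3)` (F47).  THIS FILE: the PAIR `(L_8; Ψ_8), (L_{40}; Ψ_{40})` of PRIMITIVE types has Kubota
rank `5 = (2 + 8)/2` (CORANK ONE: `Y_{40}` nondegenerate of rank `5`), the diagonal `√−2` `a = (ζ_8⁷ − ζ_8^{−7}, w)` on the product of copies
`Z = E' ⊕ E' ⊕ Y_{40}` (slot map `π₀ = (0, 0, 1)`) has a BALANCED Weil fibre (multiplicities `1 + 1 + 1 = 3 = 0 + 0 + 3`), so `(Z, φ_a)` IS OF WEIL TYPE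
`(3, 2)`; the member `Y_{40}` occurs once, the repeated member `E'` is an elliptic curve — and the weighted theory (F58b) yields:

**(∀ products `X = ⨁_j C_{π j}` of copies of `E'`, `Y_{40}`, `HC(X)`) ⟺ the rational `(3,3)` classes of the ONE Weil plane `W_k ⊂ H⁶(Z)` are algebraic**
(`forall_hodgeConjectureFor_prod_iff_weilClasses_algebraic`), each `HC(E'^a × Y_{40}^c)` and everything isogenous following from that plane
(`hodgeConjectureFor_of_isIsogenous_prod_of_weilClasses_algebraic`), and `HC(Z) ⟺ W` (`hodgeConjectureFor_sixfold_iff_weilClasses_algebraic`): the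
Hodge conjecture for the whole isogeny-closed family generated by `E'` and `Y_{40}` IS Weil's question for the sixfold `Z` of Weil type `(3, 2)` —
open in print (discriminant `2`; Markman's sixfold theorem needs a hyperbolicity datum, Schoen's covers `ℚ(√−3)`, `ℚ(i)` only).

WHAT IS PROVED (levels `lev = (8, 40)`, lower-half types `Φ_i`, index-`2` sub-pairs `(L_i; Ψ_i)`, `a_i ∈ 𝓞_{L_i}` with `a = (ζ_8⁷ − ζ_8^{−7}, ζ_{40}⁵ − ζ_{40}^{−5})`).
* §1 data: `[L_0:ℚ] = 2`, `[L_1:ℚ] = 8`, `Σ = 10`; over the slots `(0,0,1)`: `2 + 2 + 8 = 12 = 4·3`; `a_i² = −2` (F53).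
* §2 **`cmFamilyRank_ge`** — `5 ≤ cmFamilyRank Ψ` on realisations with `Y_{40}` simple and stably nondegenerate (Hazama's criterion
  `isStablyNondegenerate_iff_isNondegenerate`, `cmTypeRank Ψ_{40} = 5`, `cmTypeRank ≤ cmFamilyRank`): THE PAIR HAS CORANK ONE.
* §3 the slot counts `#{s ∈ Ψ_8 : s(a_0) = ±c} = (1, 0)`, `#{ρ ∈ Ψ_{40} : ρ(a_1) = ±c} = (1, 3)` summed over the slots `(0,0,1)`: `3` and `3`
  (`sum_ncard_slots_eq`); **`isGaloisBalancedAlg_weilFibre_slots`**, **`weilFibre_slots_mem_pohlmannSetsAlg`** (`T₀ ∈ pohlmannSetsAlg (Ψ ∘ π₀) 3`).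
* §4 on realisations `B_0 ⊨ (L_8; Ψ_8)` (`E'`), `B_1 ⊨ (L_{40}; Ψ_{40})` simple, stably nondegenerate (`Y_{40}`): `dim Z = 6`; **`isWeilType_sixfold`**
  (`(Z, φ_a)` of Weil type `(3, 2)`); **`hodgeConjectureFor_prod_of_weilClasses_algebraic`** (every `⨁_j B_{π j}`), **`…_of_isIsogenous_prod_…`**,
  **`forall_hodgeConjectureFor_prod_iff_weilClasses_algebraic`**, **`hodgeConjectureFor_sixfold_iff_weilClasses_algebraic`**,
  `hodgeConjectureFor_curve_prod_fourfold` (MZ Thm. 0.2 (3): `HC(E' × Y_{40})` ⟸ `W`; unconditionally it is F46's `B• = D•`).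
* §5 the data exist on the pieces of `J_{40}` (`exists_data_of_lev_eq_eight_forty`, from F42 ∕ F46) and hypothesis-free
  **`exists_cmCurve_simple_fourfold_forall_hodgeConjectureFor_iff`**.

HONEST.  The Weil plane's algebraicity (`hW`) is a hypothesis of the ⟸ statements and one side of the ⟺; it is Weil's 1977 question for ONE sixfold of
Weil type `(3, 2)` for `ℚ(√−2)` and is asserted nowhere.  Not here: the other pieces `X_4, X_5, X_{10}, X_{20}` of `J_{40}` (an additive nondegenerate block —
outlook), `Hg` itself, numerics (the lane's rank scan `tools/rank40.py`: ranks `5, 2; 5; 9`).  HC_CM is NOT proved.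

## References
* [MoonenZarhin1999LowDim] B. Moonen, Yu. Zarhin, Math. Ann. 315 (1999) 711–733: Introduction (g), Thm. 0.2 (3), §3 (3.1), §5 Case 2
  [corpus: paper:arxiv-math_9901113 pp. 1–2, 6, 10–11]. [cite: MoonenZarhin1999LowDim, Thm. 0.2 (3), §3 (3.1) and §5 Case 2]
* [vanGeemen1994HodgeAV] B. van Geemen, LNM 1594 (1994): 1.1, 4.9–4.11, Lemma 5.2, Thm. 6.12. [cite: vanGeemen1994HodgeAV, 1.1 and 4.9–4.11]
* [Weil1977HodgeRemarks] A. Weil, *Abelian varieties and the Hodge ring* (1977), Œuvres III [1977c]. [cite: Weil1977HodgeRemarks, pp. 421–429]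
* [Gordon1999HodgeAVSurvey] B. B. Gordon (1999): Thm. 6.4, 7.5, 7.6.1, §9.2, 9.4, 9.5. [cite: Gordon1999HodgeAVSurvey, 9.4 and 9.5]
* [Andre1992] Y. André (1992); [Milne2020HodgeClassesAV] J. S. Milne (2020): Thm. 1. [cite: Milne2020HodgeClassesAV, Thm. 1]
* [GalleseGoodsonLombardo2024] Gallese–Goodson–Lombardo (2024): §3 Thm. 3.0 (5), §3.2–3.3. [cite: GalleseGoodsonLombardo2024, §3 Thm. 3.0 (5)]
* [Shimura1998] G. Shimura (1998): §6.2 Thm. 3, §8.2 Prop. 26. [cite: Shimura1998, §8.2 Prop. 26]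
* [Washington1997] L. C. Washington: Thm. 2.5. [cite: Washington1997, Thm. 2.5]
-/

noncomputable section

open CategoryTheory CategoryTheory.Limits NumberField Module

namespace Literature.AlgebraicGeometry.ComplexMultiplication

open Literature.AlgebraicGeometry.Motives
open Literature.AlgebraicGeometry.Motives.AbelianVariety
open Literature.AlgebraicGeometry.HodgeTheory (complexBetti IsRationalClass IsOfHodgeType IsWeilType weilClassesOf algebraicClasses
  IsStablyNondegenerate HodgeConjectureFor)
open Literature.NumberTheory.ComplexMultiplication
open Literature.AlgebraicGeometry.ComplexMultiplication.CMWeights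

namespace HyperellipticJacobian

namespace WeightedForty

open Literature.AlgebraicGeometry.Pohlmann1968 Literature.AlgebraicGeometry.Pohlmann1968.Cyclotomic
open Literature.AlgebraicGeometry.Pohlmann1968.CMAlgebra

open scoped Classical Pointwise

/-! ## §1 The data of the pair `(L_8; Ψ_8), (L_{40}; Ψ_{40})` and of the slots `(0, 0, 1)` of `Z = E' ⊕ E' ⊕ Y_{40}` -/

section Data

variable {lev : Fin 2 → ℕ} [∀ i, NeZero (lev i)] {K : Fin 2 → Type} [∀ i, Field (K i)] [∀ i, NumberField (K i)]
  [∀ i, IsCyclotomicExtension {lev i} ℚ (K i)] {Φ : ∀ i, CMType (K i)}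
  {L : ∀ i, IntermediateField ℚ (K i)} {Ψ : ∀ i, CMType (L i)}

omit [∀ i, NeZero (lev i)] [∀ i, NumberField (K i)] [∀ i, IsCyclotomicExtension {lev i} ℚ (K i)] in
/-- `2 < 8, 40`. [folklore] -/
private theorem two_lt_lev (h0 : lev 0 = 8) (h1 : lev 1 = 40) : ∀ i, 2 < lev i :=
  Fin.forall_fin_two.2 ⟨by rw [h0]; norm_num, by rw [h1]; norm_num⟩

omit [∀ i, NeZero (lev i)] in
/-- The sub-pair fields `L_i` are CM fields. [cite: Shimura1998, §8.2 Prop. 26] -/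
private theorem isCMField_sub (h2 : ∀ i, 2 < lev i) (Ψ : ∀ i, CMType (L i)) (i : Fin 2) : IsCMField (L i) := by
  haveI : IsCMField (K i) := IsCyclotomicExtension.Rat.isCMField (K i) (S := {lev i}) ⟨lev i, rfl, h2 i⟩
  exact isCMField_of_cmType_intermediateField (L i) (Ψ i)

/-- **`[L_0:ℚ] = 2` and `[L_1:ℚ] = 8`** (index `2` in `ℚ(ζ_8)`, `ℚ(ζ_{40})`; `φ(8) = 4`, `φ(40) = 16`): `E' = Y_8` is an elliptic curve, `Y_{40}` a fourfold.
[cite: GalleseGoodsonLombardo2024, §3 Thm. 3.0 (5)] [cite: Washington1997, Thm. 2.5] -/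
theorem finrank_eq (h0 : lev 0 = 8) (h1 : lev 1 = 40) (hfin : ∀ i, Module.finrank (L i) (K i) = 2) :
    finrank ℚ (L 0) = 2 ∧ finrank ℚ (L 1) = 8 := by
  have hK : ∀ i, finrank ℚ (K i) = (lev i).totient := fun i =>
    IsCyclotomicExtension.finrank (K := ℚ) (n := lev i) (K i) (Polynomial.cyclotomic.irreducible_rat (Nat.pos_of_ne_zero (NeZero.ne _)))
  have htower : ∀ i, finrank ℚ (L i) * 2 = (lev i).totient := fun i => by rw [← hfin i, Module.finrank_mul_finrank ℚ (L i) (K i), hK i]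
  have ht0 := htower 0
  have ht1 := htower 1
  rw [h0, show Nat.totient 8 = 4 by decide] at ht0
  rw [h1, show Nat.totient 40 = 16 by decide] at ht1
  constructor <;> omega

/-- `Σ_i [L_i : ℚ] = 10 = 2 dim(E' × Y_{40})`. [cite: GalleseGoodsonLombardo2024, §3 Thm. 3.0 (5)] -/
theorem sum_finrank_eq (h0 : lev 0 = 8) (h1 : lev 1 = 40) (hfin : ∀ i, Module.finrank (L i) (K i) = 2) : ∑ i, finrank ℚ (L i) = 10 := by
  obtain ⟨hd0, hd1⟩ := finrank_eq (K := K) h0 h1 hfin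
  rw [Fin.sum_univ_two, hd0, hd1]

/-- `Σ_{j<3} [L_{π₀ j} : ℚ] = 2 + 2 + 8 = 12 = 4 · 3` over the slots `π₀ = (0, 0, 1)` of `Z = E' ⊕ E' ⊕ Y_{40}`: `dim Z = 6`, Weil degree `m = 3`.
[cite: MoonenZarhin1999LowDim, §5 Case 2] -/
theorem sum_finrank_slots_eq (h0 : lev 0 = 8) (h1 : lev 1 = 40) (hfin : ∀ i, Module.finrank (L i) (K i) = 2) :
    4 * 3 = ∑ j : Fin 3, finrank ℚ (L ((![0, 0, 1] : Fin 3 → Fin 2) j)) := by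
  obtain ⟨hd0, hd1⟩ := finrank_eq (K := K) h0 h1 hfin
  rw [Fin.sum_univ_three]
  show 4 * 3 = finrank ℚ (L 0) + finrank ℚ (L 0) + finrank ℚ (L 1)
  rw [hd0, hd1]

omit [∀ i, NeZero (lev i)] [∀ i, NumberField (K i)] [∀ i, IsCyclotomicExtension {lev i} ℚ (K i)] in
/-- The slot map `π₀ = (0, 0, 1)` hits both members, the member `1` (`Y_{40}`) exactly once (slot `2`), and two distinct slots over one member are the
two `E'`-slots. [folklore] -/
private theorem slotMap_facts :
    (∀ i : Fin 2, ∃ j : Fin 3, (![0, 0, 1] : Fin 3 → Fin 2) j = i) ∧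
    (∀ j : Fin 3, (![0, 0, 1] : Fin 3 → Fin 2) j = (![0, 0, 1] : Fin 3 → Fin 2) 2 → j = 2) ∧
    (∀ j₁ j₂ : Fin 3, j₁ ≠ j₂ → (![0, 0, 1] : Fin 3 → Fin 2) j₁ = (![0, 0, 1] : Fin 3 → Fin 2) j₂ → (![0, 0, 1] : Fin 3 → Fin 2) j₁ = 0) := by
  refine ⟨?_, ?_, ?_⟩ <;> decide

end Data

/-! ## §2 The pair has Kubota corank ONE: `5 = (2 + 8)/2 ≤ cmFamilyRank Ψ` (`Y_{40}` nondegenerate of rank `5`) -/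

section Rank

variable {lev : Fin 2 → ℕ} [∀ i, NeZero (lev i)] {K : Fin 2 → Type} [∀ i, Field (K i)] [∀ i, NumberField (K i)]
  [∀ i, IsCyclotomicExtension {lev i} ℚ (K i)] {Φ : ∀ i, CMType (K i)}
  {L : ∀ i, IntermediateField ℚ (K i)} {Ψ : ∀ i, CMType (L i)}
  {B : Fin 2 → AbelianVariety ℂ} {ιB : ∀ i, 𝓞 (L i) →+* End (B i)} {θB : ∀ i, L i →+* Module.End ℂ (complexBetti (B i).X 1)}

/-- **THE PAIR `(L_8; Ψ_8), (L_{40}; Ψ_{40})` HAS KUBOTA CORANK ONE: `(Σ_i [L_i:ℚ])/2 = 5 ≤ cmFamilyRank Ψ`** — `Y_{40}` is simple (so `Ψ_{40}` is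
primitive, Shimura §8.2 Prop. 26) and stably nondegenerate, hence `Ψ_{40}` is nondegenerate (Hazama's criterion, Gordon Thm. 6.4 ∕ 9.4) of rank
`[L_{40}:ℚ]/2 + 1 = 5`, and the rank of a member bounds the rank of the family below (MZ (3.1): `Hg(X) ↠ Hg(X_i)`).  (Equality `cmFamilyRank = 5`, i.e.
`Hg(E' × Y_{40}) ≠ Hg(E') × Hg(Y_{40})`, is MZ Thm. 0.2 (3); only `≥` is used.) [cite: MoonenZarhin1999LowDim, Thm. 0.2 (3) and §3 (3.1)]
[cite: Gordon1999HodgeAVSurvey, Thm. 6.4 and 9.4] [cite: Shimura1998, §8.2 Prop. 26] -/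
theorem cmFamilyRank_ge (h0 : lev 0 = 8) (h1 : lev 1 = 40) (hfin : ∀ i, Module.finrank (L i) (K i) = 2)
    (hB : ∀ i, IsCMTypeRealisation (Ψ i) (B i) (ιB i) (θB i)) (hs : (B 1).IsSimple) (hst : IsStablyNondegenerate (B 1)) :
    (∑ i, finrank ℚ (L i)) / 2 ≤ cmFamilyRank Ψ := by
  haveI : ∀ i, IsCMField (L i) := isCMField_sub (two_lt_lev h0 h1) Ψ
  obtain ⟨φ₀⟩ := (inferInstance : Nonempty (L 1 →+* ℂ))
  have hprim := (isSimple_iff_isPrimitive (hB 1) φ₀).1 hs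
  have hnd : IsNondegenerate (Ψ 1) := (isStablyNondegenerate_iff_isNondegenerate φ₀ hprim (hB 1)).1 hst
  have hrank1 : cmTypeRank (Ψ 1) = finrank ℚ (L 1) / 2 + 1 := (isNondegenerate_iff (Ψ 1)).1 hnd
  obtain ⟨-, hd1⟩ := finrank_eq (K := K) h0 h1 hfin
  rw [sum_finrank_eq h0 h1 hfin]
  have hle := cmTypeRank_le_cmFamilyRank Ψ 1
  rw [hrank1, hd1] at hle
  exact hle

end Rank

/-! ## §3 The Weil fibre of `a = (a_0, a_0, a_1)` on the slots of `Z` is BALANCED: multiplicities `1 + 1 + 1 = 3 = 0 + 0 + 3` -/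

section Counts

variable {lev : Fin 2 → ℕ} [∀ i, NeZero (lev i)] {K : Fin 2 → Type} [∀ i, Field (K i)] [∀ i, NumberField (K i)]
  [∀ i, IsCyclotomicExtension {lev i} ℚ (K i)] {Φ : ∀ i, CMType (K i)}
  {L : ∀ i, IntermediateField ℚ (K i)} {Ψ : ∀ i, CMType (L i)}

omit [∀ i, NeZero (lev i)] [∀ i, IsCyclotomicExtension {lev i} ℚ (K i)] in
/-- A count on `⊔_{j<3} Hom(L_{π₀ j}, ℂ)` is the sum of the three slot counts. [cite: GaoUllmo2025, Thm. 3.1 (3.2)] -/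
private theorem ncard_sigma_slots_eq_sum (Q : ∀ j : Fin 3, (L ((![0, 0, 1] : Fin 3 → Fin 2) j) →+* ℂ) → Prop) :
    {x : (j : Fin 3) × (L ((![0, 0, 1] : Fin 3 → Fin 2) j) →+* ℂ) | Q x.1 x.2}.ncard =
      ∑ j : Fin 3, {s : L ((![0, 0, 1] : Fin 3 → Fin 2) j) →+* ℂ | Q j s}.ncard := by
  have hset : {x : (j : Fin 3) × (L ((![0, 0, 1] : Fin 3 → Fin 2) j) →+* ℂ) | Q x.1 x.2} =
      ↑(Finset.univ.sigma fun j => Finset.univ.filter fun s : L ((![0, 0, 1] : Fin 3 → Fin 2) j) →+* ℂ => Q j s) := by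
    ext x
    simp only [Set.mem_setOf_eq, Finset.coe_sigma, Set.mem_sigma_iff, Finset.mem_coe, Finset.mem_univ, Finset.mem_filter, true_and]
  rw [hset, Set.ncard_coe_finset, Finset.card_sigma]
  refine Finset.sum_congr rfl fun j _ => ?_
  rw [show {s : L ((![0, 0, 1] : Fin 3 → Fin 2) j) →+* ℂ | Q j s} =
      ↑(Finset.univ.filter fun s : L ((![0, 0, 1] : Fin 3 → Fin 2) j) →+* ℂ => Q j s) by
    ext s; simp only [Set.mem_setOf_eq, Finset.coe_filter, Finset.mem_univ, true_and], Set.ncard_coe_finset]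

omit [∀ i, NeZero (lev i)] [∀ i, IsCyclotomicExtension {lev i} ℚ (K i)] in
/-- Counts along a sub-pair `(L ≤ K; Ψ)`, `Ψ^K = Φ`: `#{σ ∈ Φ : σ(x) = c} = [K : L] · #{ρ ∈ Ψ : ρ(x) = c}`. [cite: Shimura1998, §6.2 Thm. 3 (proof)] -/
private theorem ncard_restrict_eq_mul (i : Fin 2) (hind : inducedCMType (algebraMap (L i) (K i)) (Ψ i) = Φ i) (x : L i) (c : ℂ) :
    {σ : K i →+* ℂ | σ ∈ (Φ i).1 ∧ σ (x : K i) = c}.ncard = Module.finrank (L i) (K i) * {ρ : L i →+* ℂ | ρ ∈ (Ψ i).1 ∧ ρ x = c}.ncard := by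
  have h := card_filter_comp_mem (K := K i) (L := L i) (Finset.univ.filter fun ρ : L i →+* ℂ => ρ ∈ (Ψ i).1 ∧ ρ x = c)
  have e1 : {σ : K i →+* ℂ | σ ∈ (Φ i).1 ∧ σ (x : K i) = c} = ↑(Finset.univ.filter fun σ : K i →+* ℂ =>
      σ.comp (algebraMap (L i) (K i)) ∈ (Finset.univ.filter fun ρ : L i →+* ℂ => ρ ∈ (Ψ i).1 ∧ ρ x = c)) := by
    ext σ
    simp only [Set.mem_setOf_eq, Finset.coe_filter, Finset.mem_filter, Finset.mem_univ, true_and, RingHom.coe_comp,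
      Function.comp_apply, ← hind, mem_inducedCMType_iff]
    rfl
  have e2 : {ρ : L i →+* ℂ | ρ ∈ (Ψ i).1 ∧ ρ x = c} = ↑(Finset.univ.filter fun ρ : L i →+* ℂ => ρ ∈ (Ψ i).1 ∧ ρ x = c) := by
    ext ρ
    simp only [Set.mem_setOf_eq, Finset.coe_filter, Finset.mem_univ, true_and]
  rw [e1, e2, Set.ncard_coe_finset, Set.ncard_coe_finset, h]

/-- `(i√2)² = −2`. [folklore] -/
private theorem I_mul_sqrt_two_sq' : (Complex.I * (Real.sqrt ((2 : ℕ) : ℝ) : ℂ)) ^ 2 = -2 := by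
  rw [mul_pow, Complex.I_sq, ← Complex.ofReal_pow, Nat.cast_ofNat, Real.sq_sqrt (by norm_num)]
  push_cast
  ring

/-- A complex number with square `−2` is `± i√2`. [folklore] -/
private theorem eq_or_eq_neg_of_sq_eq_neg_two' {c : ℂ} (hc : c ^ 2 = -2) :
    c = Complex.I * (Real.sqrt ((2 : ℕ) : ℝ) : ℂ) ∨ c = -(Complex.I * (Real.sqrt ((2 : ℕ) : ℝ) : ℂ)) :=
  sq_eq_sq_iff_eq_or_eq_neg.1 (by rw [hc, I_mul_sqrt_two_sq'])

set_option maxHeartbeats 1000000 in -- the dependent slot family `L (![0, 0, 1] j)` makes unification slow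
/-- **THE SLOT COUNTS OF `Z = E' ⊕ E' ⊕ Y_{40}`** (F50's `(2, 0)` on `Φ_8` halved along the index-`2` sub-pair `(L_8; Ψ_8)`: `(1, 0)` per `E'`-slot; F47 ∕ F50's
`(1, 3)` on `Ψ_{40}`): for `μ = i√2`, `Σ_{j<3} #{s ∈ Ψ_{π₀ j} : s(a_{π₀ j}) = μ} = 3` and `Σ_{j<3} #{s ∈ Ψ_{π₀ j} : s(a_{π₀ j}) = −μ} = 3` — «`k` acts on
`T_{Z,0}` with multiplicities `(3,3)`». [cite: MoonenZarhin1999LowDim, §5 Case 2] [cite: vanGeemen1994HodgeAV, 4.9] -/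
theorem sum_ncard_slots_eq (h0 : lev 0 = 8) (h1 : lev 1 = 40)
    (hΦ : ∀ i (σ : K i →+* ℂ), σ ∈ (Φ i).1 ↔ 2 * (expOf (lev i) (K i) σ).val < lev i)
    (hind : ∀ i, inducedCMType (algebraMap (L i) (K i)) (Ψ i) = Φ i) (hfin : ∀ i, Module.finrank (L i) (K i) = 2) (a : ∀ i, 𝓞 (L i))
    (ha : ∀ i, (((a i : L i)) : K i) = zetaOf (lev i) (K i) ^ ((![7, 5] : Fin 2 → ℕ) i) - (zetaOf (lev i) (K i) ^ ((![7, 5] : Fin 2 → ℕ) i))⁻¹) :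
    (∑ j : Fin 3, {s : L ((![0, 0, 1] : Fin 3 → Fin 2) j) →+* ℂ | s ∈ (Ψ ((![0, 0, 1] : Fin 3 → Fin 2) j)).1 ∧
        s (a ((![0, 0, 1] : Fin 3 → Fin 2) j) : L ((![0, 0, 1] : Fin 3 → Fin 2) j)) = Complex.I * (Real.sqrt ((2 : ℕ) : ℝ) : ℂ)}.ncard) = 3 ∧
    (∑ j : Fin 3, {s : L ((![0, 0, 1] : Fin 3 → Fin 2) j) →+* ℂ | s ∈ (Ψ ((![0, 0, 1] : Fin 3 → Fin 2) j)).1 ∧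
        s (a ((![0, 0, 1] : Fin 3 → Fin 2) j) : L ((![0, 0, 1] : Fin 3 → Fin 2) j)) = -(Complex.I * (Real.sqrt ((2 : ℕ) : ℝ) : ℂ))}.ncard) = 3 := by
  have hw : zetaOf (lev 1) (K 1) ^ 5 - (zetaOf (lev 1) (K 1) ^ 5)⁻¹ ∈ L 1 := by
    have h := (a 1 : L 1).2
    rw [show ((a 1 : L 1) : K 1) = zetaOf (lev 1) (K 1) ^ 5 - (zetaOf (lev 1) (K 1) ^ 5)⁻¹ from ha 1] at h
    exact h
  obtain ⟨c, hc2, hP, hM⟩ := weilType_multiplicities_cmCurveSq_simpleFourfold h0 h1 (Φ 0) (hΦ 0) (Φ 1) (hΦ 1) (hind 1) (hfin 1) hw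
  -- slot `0`: half of F50's count on `Φ_8`
  have e0 : ∀ c' : ℂ, 2 * {s : L 0 →+* ℂ | s ∈ (Ψ 0).1 ∧ s (a 0 : L 0) = c'}.ncard =
      {σ : K 0 →+* ℂ | σ ∈ (Φ 0).1 ∧ σ (zetaOf (lev 0) (K 0) ^ 7 - (zetaOf (lev 0) (K 0) ^ 7)⁻¹) = c'}.ncard := fun c' => by
    rw [show zetaOf (lev 0) (K 0) ^ 7 - (zetaOf (lev 0) (K 0) ^ 7)⁻¹ = ((a 0 : L 0) : K 0) from (ha 0).symm,
      ncard_restrict_eq_mul 0 (hind 0) (a 0 : L 0) c', hfin 0]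
  -- slot `1`
  have e1 : ∀ c' : ℂ, {s : L 1 →+* ℂ | s ∈ (Ψ 1).1 ∧ s (a 1 : L 1) = c'}.ncard = {ρ : L 1 →+* ℂ | ρ ∈ (Ψ 1).1 ∧ ρ ⟨_, hw⟩ = c'}.ncard :=
    fun c' => by
    have : (a 1 : L 1) = ⟨_, hw⟩ := Subtype.ext (ha 1)
    rw [this]
  have key : ∀ c' : ℂ, (∑ j : Fin 3, {s : L ((![0, 0, 1] : Fin 3 → Fin 2) j) →+* ℂ | s ∈ (Ψ ((![0, 0, 1] : Fin 3 → Fin 2) j)).1 ∧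
      s (a ((![0, 0, 1] : Fin 3 → Fin 2) j) : L ((![0, 0, 1] : Fin 3 → Fin 2) j)) = c'}.ncard) =
      {σ : K 0 →+* ℂ | σ ∈ (Φ 0).1 ∧ σ (zetaOf (lev 0) (K 0) ^ 7 - (zetaOf (lev 0) (K 0) ^ 7)⁻¹) = c'}.ncard +
        {ρ : L 1 →+* ℂ | ρ ∈ (Ψ 1).1 ∧ ρ ⟨_, hw⟩ = c'}.ncard := fun c' => by
    rw [Fin.sum_univ_three, ← e0, ← e1]
    show {s : L 0 →+* ℂ | s ∈ (Ψ 0).1 ∧ s (a 0 : L 0) = c'}.ncard + {s : L 0 →+* ℂ | s ∈ (Ψ 0).1 ∧ s (a 0 : L 0) = c'}.ncard +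
      {s : L 1 →+* ℂ | s ∈ (Ψ 1).1 ∧ s (a 1 : L 1) = c'}.ncard = _
    ring
  rw [key, key]
  rcases eq_or_eq_neg_of_sq_eq_neg_two' hc2 with rfl | rfl
  · exact ⟨hP, hM⟩
  · rw [neg_neg] at hM
    exact ⟨hM, hP⟩

set_option maxHeartbeats 1000000 in -- the dependent slot family `L (![0, 0, 1] j)` makes unification slow
/-- **`#(T₀ ∩ Σ) = 3 = #(T̄₀ ∩ Σ)`** for the Weil fibre `T₀ = {(j, s) : s(a_{π₀ j}) = i√2}` of the slot family of `Z` and the fibre of `−i√2`.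
[cite: MoonenZarhin1999LowDim, §5 Case 2] [cite: vanGeemen1994HodgeAV, 4.9 and Lemma 5.2] -/
theorem ncard_weilFibre_slots_sep_eq (h0 : lev 0 = 8) (h1 : lev 1 = 40)
    (hΦ : ∀ i (σ : K i →+* ℂ), σ ∈ (Φ i).1 ↔ 2 * (expOf (lev i) (K i) σ).val < lev i)
    (hind : ∀ i, inducedCMType (algebraMap (L i) (K i)) (Ψ i) = Φ i) (hfin : ∀ i, Module.finrank (L i) (K i) = 2) (a : ∀ i, 𝓞 (L i))
    (ha : ∀ i, (((a i : L i)) : K i) = zetaOf (lev i) (K i) ^ ((![7, 5] : Fin 2 → ℕ) i) - (zetaOf (lev i) (K i) ^ ((![7, 5] : Fin 2 → ℕ) i))⁻¹) :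
    {x | x ∈ (Finset.univ.filter fun y : (j : Fin 3) × (L ((![0, 0, 1] : Fin 3 → Fin 2) j) →+* ℂ) =>
        y.2 ((a ((![0, 0, 1] : Fin 3 → Fin 2) y.1) : 𝓞 (L ((![0, 0, 1] : Fin 3 → Fin 2) y.1))) : L ((![0, 0, 1] : Fin 3 → Fin 2) y.1)) =
          Complex.I * (Real.sqrt ((2 : ℕ) : ℝ) : ℂ)) ∧ x.2 ∈ (Ψ ((![0, 0, 1] : Fin 3 → Fin 2) x.1)).1}.ncard = 3 ∧
    {x | x ∈ (Finset.univ.filter fun y : (j : Fin 3) × (L ((![0, 0, 1] : Fin 3 → Fin 2) j) →+* ℂ) =>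
        y.2 ((a ((![0, 0, 1] : Fin 3 → Fin 2) y.1) : 𝓞 (L ((![0, 0, 1] : Fin 3 → Fin 2) y.1))) : L ((![0, 0, 1] : Fin 3 → Fin 2) y.1)) =
          -(Complex.I * (Real.sqrt ((2 : ℕ) : ℝ) : ℂ))) ∧ x.2 ∈ (Ψ ((![0, 0, 1] : Fin 3 → Fin 2) x.1)).1}.ncard = 3 := by
  obtain ⟨hI, hnI⟩ := sum_ncard_slots_eq h0 h1 hΦ hind hfin a ha
  have key : ∀ c : ℂ, {x | x ∈ (Finset.univ.filter fun y : (j : Fin 3) × (L ((![0, 0, 1] : Fin 3 → Fin 2) j) →+* ℂ) =>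
      y.2 ((a ((![0, 0, 1] : Fin 3 → Fin 2) y.1) : 𝓞 (L ((![0, 0, 1] : Fin 3 → Fin 2) y.1))) : L ((![0, 0, 1] : Fin 3 → Fin 2) y.1)) = c) ∧
      x.2 ∈ (Ψ ((![0, 0, 1] : Fin 3 → Fin 2) x.1)).1}.ncard =
      ∑ j : Fin 3, {s : L ((![0, 0, 1] : Fin 3 → Fin 2) j) →+* ℂ | s ∈ (Ψ ((![0, 0, 1] : Fin 3 → Fin 2) j)).1 ∧
        s (a ((![0, 0, 1] : Fin 3 → Fin 2) j) : L ((![0, 0, 1] : Fin 3 → Fin 2) j)) = c}.ncard := fun c => by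
    rw [← ncard_sigma_slots_eq_sum (L := L) (fun j s => s ∈ (Ψ ((![0, 0, 1] : Fin 3 → Fin 2) j)).1 ∧
      s (a ((![0, 0, 1] : Fin 3 → Fin 2) j) : L ((![0, 0, 1] : Fin 3 → Fin 2) j)) = c)]
    congr 1
    ext x
    simp only [Set.mem_setOf_eq, Finset.mem_filter, Finset.mem_univ, true_and]
    tauto
  exact ⟨by rw [key, hI], by rw [key, hnI]⟩

set_option maxHeartbeats 1000000 in -- the dependent slot family `L (![0, 0, 1] j)` makes unification slow
/-- **THE WEIL FIBRE `T₀` OF `Z = E' ⊕ E' ⊕ Y_{40}` SATISFIES POHLMANN'S CONDITION** (`Aut(ℂ)` moves it to itself or to `T̄₀`, F51a `smul_weilFibre_eq_or`;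
the one count balances, F51a `isGaloisBalancedAlg_of_smul_eq_or`): «the corresponding space of Weil classes `W_k ⊂ H⁶(Z, ℚ)` consists of Hodge classes»
at the level of CM types (Deligne–Milne 4.4). [cite: MoonenZarhin1999LowDim, §5 Case 2] [cite: Deligne1982HodgeCycles, §4 Prop. 4.4]
[cite: GaoUllmo2025, Thm. 3.1 (3.2)] -/
theorem isGaloisBalancedAlg_weilFibre_slots (h0 : lev 0 = 8) (h1 : lev 1 = 40)
    (hΦ : ∀ i (σ : K i →+* ℂ), σ ∈ (Φ i).1 ↔ 2 * (expOf (lev i) (K i) σ).val < lev i)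
    (hind : ∀ i, inducedCMType (algebraMap (L i) (K i)) (Ψ i) = Φ i) (hfin : ∀ i, Module.finrank (L i) (K i) = 2) (a : ∀ i, 𝓞 (L i))
    (ha : ∀ i, (((a i : L i)) : K i) = zetaOf (lev i) (K i) ^ ((![7, 5] : Fin 2 → ℕ) i) - (zetaOf (lev i) (K i) ^ ((![7, 5] : Fin 2 → ℕ) i))⁻¹) :
    IsGaloisBalancedAlg (K := fun j : Fin 3 => L ((![0, 0, 1] : Fin 3 → Fin 2) j)) (fun j => Ψ ((![0, 0, 1] : Fin 3 → Fin 2) j))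
      (Finset.univ.filter fun y : (j : Fin 3) × (L ((![0, 0, 1] : Fin 3 → Fin 2) j) →+* ℂ) =>
        y.2 ((a ((![0, 0, 1] : Fin 3 → Fin 2) y.1) : 𝓞 (L ((![0, 0, 1] : Fin 3 → Fin 2) y.1))) : L ((![0, 0, 1] : Fin 3 → Fin 2) y.1)) =
          Complex.I * (Real.sqrt ((2 : ℕ) : ℝ) : ℂ)) := by
  haveI : ∀ i, IsCMField (L i) := isCMField_sub (two_lt_lev h0 h1) Ψ
  have ha2 := WeilPlaneForty.sq_a_eq h0 h1 a ha
  have ha2' : ∀ j : Fin 3, a ((![0, 0, 1] : Fin 3 → Fin 2) j) * a ((![0, 0, 1] : Fin 3 → Fin 2) j) =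
      -((2 : ℕ) : 𝓞 (L ((![0, 0, 1] : Fin 3 → Fin 2) j))) := fun j => ha2 _
  obtain ⟨hI, hnI⟩ := ncard_weilFibre_slots_sep_eq h0 h1 hΦ hind hfin a ha
  refine CorankOne.isGaloisBalancedAlg_of_smul_eq_or (K := fun j : Fin 3 => L ((![0, 0, 1] : Fin 3 → Fin 2) j))
    (fun j => Ψ ((![0, 0, 1] : Fin 3 → Fin 2) j))
    (CorankOne.smul_weilFibre_eq_or (K := fun j : Fin 3 => L ((![0, 0, 1] : Fin 3 → Fin 2) j))
      (fun j => a ((![0, 0, 1] : Fin 3 → Fin 2) j)) two_pos ha2') ?_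
  have h2 := ncard_sep_conj_smul_mem (K := fun j : Fin 3 => L ((![0, 0, 1] : Fin 3 → Fin 2) j)) (fun j => Ψ ((![0, 0, 1] : Fin 3 → Fin 2) j))
    (1 : ℂ ≃+* ℂ)
    (Finset.univ.filter fun y : (j : Fin 3) × (L ((![0, 0, 1] : Fin 3 → Fin 2) j) →+* ℂ) =>
      y.2 ((a ((![0, 0, 1] : Fin 3 → Fin 2) y.1) : 𝓞 (L ((![0, 0, 1] : Fin 3 → Fin 2) y.1))) : L ((![0, 0, 1] : Fin 3 → Fin 2) y.1)) =
        Complex.I * (Real.sqrt ((2 : ℕ) : ℝ) : ℂ))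
  have hone : ∀ x : (j : Fin 3) × (L ((![0, 0, 1] : Fin 3 → Fin 2) j) →+* ℂ), ((1 : ℂ ≃+* ℂ) : ℂ →+* ℂ).comp x.2 = x.2 :=
    fun x => RingHom.ext fun _ => rfl
  simp only [hone] at h2
  have hconj : {x | x ∈ (starRingAut : ℂ ≃+* ℂ) • (Finset.univ.filter fun y : (j : Fin 3) × (L ((![0, 0, 1] : Fin 3 → Fin 2) j) →+* ℂ) =>
      y.2 ((a ((![0, 0, 1] : Fin 3 → Fin 2) y.1) : 𝓞 (L ((![0, 0, 1] : Fin 3 → Fin 2) y.1))) : L ((![0, 0, 1] : Fin 3 → Fin 2) y.1)) =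
        Complex.I * (Real.sqrt ((2 : ℕ) : ℝ) : ℂ)) ∧ x.2 ∈ (Ψ ((![0, 0, 1] : Fin 3 → Fin 2) x.1)).1}.ncard =
      {x | x ∈ (Finset.univ.filter fun y : (j : Fin 3) × (L ((![0, 0, 1] : Fin 3 → Fin 2) j) →+* ℂ) =>
        y.2 ((a ((![0, 0, 1] : Fin 3 → Fin 2) y.1) : 𝓞 (L ((![0, 0, 1] : Fin 3 → Fin 2) y.1))) : L ((![0, 0, 1] : Fin 3 → Fin 2) y.1)) =
          -(Complex.I * (Real.sqrt ((2 : ℕ) : ℝ) : ℂ))) ∧ x.2 ∈ (Ψ ((![0, 0, 1] : Fin 3 → Fin 2) x.1)).1}.ncard := by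
    congr 1
    ext x
    simp only [Set.mem_setOf_eq]
    rw [CorankOne.mem_conj_smul_weilFibre_iff (K := fun j : Fin 3 => L ((![0, 0, 1] : Fin 3 → Fin 2) j))
      (fun j => a ((![0, 0, 1] : Fin 3 → Fin 2) j)) two_pos ha2' x]
    simp only [Finset.mem_filter, Finset.mem_univ, true_and]
  rw [hI, ← h2, hconj, hnI]

set_option maxHeartbeats 1000000 in -- the dependent slot family `L (![0, 0, 1] j)` makes unification slow
/-- **`T₀ ∈ pohlmannSetsAlg (Ψ ∘ π₀) 3`**: `|T₀| = 6 = dim Z` (a transversal of conjugation) and `T₀` is balanced — the line `H⁶(Z)_{T₀}` consists of Hodge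
classes (Pohlmann ∕ Gao–Ullmo Thm. 3.1). [cite: GaoUllmo2025, Thm. 3.1] [cite: MoonenZarhin1999LowDim, §5 Case 2] -/
theorem weilFibre_slots_mem_pohlmannSetsAlg (h0 : lev 0 = 8) (h1 : lev 1 = 40)
    (hΦ : ∀ i (σ : K i →+* ℂ), σ ∈ (Φ i).1 ↔ 2 * (expOf (lev i) (K i) σ).val < lev i)
    (hind : ∀ i, inducedCMType (algebraMap (L i) (K i)) (Ψ i) = Φ i) (hfin : ∀ i, Module.finrank (L i) (K i) = 2) (a : ∀ i, 𝓞 (L i))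
    (ha : ∀ i, (((a i : L i)) : K i) = zetaOf (lev i) (K i) ^ ((![7, 5] : Fin 2 → ℕ) i) - (zetaOf (lev i) (K i) ^ ((![7, 5] : Fin 2 → ℕ) i))⁻¹) :
    (Finset.univ.filter fun y : (j : Fin 3) × (L ((![0, 0, 1] : Fin 3 → Fin 2) j) →+* ℂ) =>
        y.2 ((a ((![0, 0, 1] : Fin 3 → Fin 2) y.1) : 𝓞 (L ((![0, 0, 1] : Fin 3 → Fin 2) y.1))) : L ((![0, 0, 1] : Fin 3 → Fin 2) y.1)) =
          Complex.I * (Real.sqrt ((2 : ℕ) : ℝ) : ℂ)) ∈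
      pohlmannSetsAlg (K := fun j : Fin 3 => L ((![0, 0, 1] : Fin 3 → Fin 2) j)) (fun j => Ψ ((![0, 0, 1] : Fin 3 → Fin 2) j)) 3 := by
  haveI : ∀ i, IsCMField (L i) := isCMField_sub (two_lt_lev h0 h1) Ψ
  have ha2 := WeilPlaneForty.sq_a_eq h0 h1 a ha
  have ha2' : ∀ j : Fin 3, a ((![0, 0, 1] : Fin 3 → Fin 2) j) * a ((![0, 0, 1] : Fin 3 → Fin 2) j) =
      -((2 : ℕ) : 𝓞 (L ((![0, 0, 1] : Fin 3 → Fin 2) j))) := fun j => ha2 _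
  have hcard := CorankOne.two_mul_card_eq_sum_finrank (K := fun j : Fin 3 => L ((![0, 0, 1] : Fin 3 → Fin 2) j))
    (CorankOne.mem_weilFibre_iff_conj_smul_not_mem (K := fun j : Fin 3 => L ((![0, 0, 1] : Fin 3 → Fin 2) j))
      (fun j => a ((![0, 0, 1] : Fin 3 → Fin 2) j)) two_pos ha2')
  rw [← sum_finrank_slots_eq h0 h1 hfin] at hcard
  exact ⟨by omega, isGaloisBalancedAlg_weilFibre_slots h0 h1 hΦ hind hfin a ha⟩

end Counts

/-! ## §4 On realisations `E' ⊨ (L_8; Ψ_8)`, `Y_{40} ⊨ (L_{40}; Ψ_{40})` simple and stably nondegenerate: WEIL TYPE `(3, 2)` of `Z = E' ⊕ E' ⊕ Y_{40}` and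
## THE HODGE CONJECTURE FOR EVERY PRODUCT OF COPIES ⟺ THE ONE WEIL PLANE OF `Z` -/

section Geometry

variable {lev : Fin 2 → ℕ} [∀ i, NeZero (lev i)] {K : Fin 2 → Type} [∀ i, Field (K i)] [∀ i, NumberField (K i)]
  [∀ i, IsCyclotomicExtension {lev i} ℚ (K i)] {Φ : ∀ i, CMType (K i)}
  {L : ∀ i, IntermediateField ℚ (K i)} {Ψ : ∀ i, CMType (L i)}
  {B : Fin 2 → AbelianVariety ℂ} {ιB : ∀ i, 𝓞 (L i) →+* End (B i)} {θB : ∀ i, L i →+* Module.End ℂ (complexBetti (B i).X 1)}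

/-- **`dim E' = 1`, `dim Y_{40} = 4`, `dim Z = dim(E' ⊕ E' ⊕ Y_{40}) = 6`.** [cite: MoonenZarhin1999LowDim, §5 Case 2] [cite: GalleseGoodsonLombardo2024, §3 Thm. 3.0 (5)] -/
theorem dim_eq (h0 : lev 0 = 8) (h1 : lev 1 = 40) (hfin : ∀ i, Module.finrank (L i) (K i) = 2)
    (hB : ∀ i, IsCMTypeRealisation (Ψ i) (B i) (ιB i) (θB i)) :
    (B 0).dim = 1 ∧ (B 1).dim = 4 ∧ (⨁ fun j : Fin 3 => B ((![0, 0, 1] : Fin 3 → Fin 2) j)).dim = 6 := by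
  obtain ⟨hd0, hd1⟩ := finrank_eq (K := K) h0 h1 hfin
  have h12 := sum_finrank_slots_eq (K := K) h0 h1 hfin
  refine ⟨?_, ?_, ?_⟩
  · have h : (B 0).dim = finrank ℚ (L 0) / 2 := Motives.schemeDim_eq_holds (hB 0).1
    rw [hd0] at h
    simpa using h
  · have h : (B 1).dim = finrank ℚ (L 1) / 2 := Motives.schemeDim_eq_holds (hB 1).1
    rw [hd1] at h
    simpa using h
  · rw [CorankOne.dim_biproduct_eq (K := fun j : Fin 3 => L ((![0, 0, 1] : Fin 3 → Fin 2) j)) (fun j => hB ((![0, 0, 1] : Fin 3 → Fin 2) j)),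
      ← h12]

set_option maxHeartbeats 1000000 in -- the dependent slot family `L (![0, 0, 1] j)` makes unification slow
/-- **`(Z = E' ⊕ E' ⊕ Y_{40}, φ_a)` IS AN ABELIAN SIXFOLD OF WEIL TYPE `(3, 2)` FOR `k = ℚ(√−2)`**, `φ_a = ι(a_0) ⊕ ι(a_0) ⊕ ι(a_1)` (`φ_a² = −2`, `i√2` of multiplicity
`3` on `H^{1,0}`): Moonen–Zarhin §5 Case 2 «there is an embedding `k ↪ End⁰(Z)` such that `k` acts on `T_{Z,0}` with multiplicities `(3,3)`», at the
level of Hodge structures (F51a `isWeilType` for the slot family: the balanced Weil fibre indexes a non-zero line of `(3,3)`-classes in the Weil plane).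
[cite: MoonenZarhin1999LowDim, §5 Case 2] [cite: Deligne1982HodgeCycles, §4 Prop. 4.4] [cite: vanGeemen1994HodgeAV, 4.9–4.10] -/
theorem isWeilType_sixfold (h0 : lev 0 = 8) (h1 : lev 1 = 40)
    (hΦ : ∀ i (σ : K i →+* ℂ), σ ∈ (Φ i).1 ↔ 2 * (expOf (lev i) (K i) σ).val < lev i)
    (hind : ∀ i, inducedCMType (algebraMap (L i) (K i)) (Ψ i) = Φ i) (hfin : ∀ i, Module.finrank (L i) (K i) = 2) (a : ∀ i, 𝓞 (L i))
    (ha : ∀ i, (((a i : L i)) : K i) = zetaOf (lev i) (K i) ^ ((![7, 5] : Fin 2 → ℕ) i) - (zetaOf (lev i) (K i) ^ ((![7, 5] : Fin 2 → ℕ) i))⁻¹)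
    (hB : ∀ i, IsCMTypeRealisation (Ψ i) (B i) (ιB i) (θB i)) :
    IsWeilType (⨁ fun j : Fin 3 => B ((![0, 0, 1] : Fin 3 → Fin 2) j))
      (biproduct.map fun j : Fin 3 => ιB ((![0, 0, 1] : Fin 3 → Fin 2) j) (a ((![0, 0, 1] : Fin 3 → Fin 2) j))) 3 2 := by
  haveI : ∀ i, IsCMField (L i) := isCMField_sub (two_lt_lev h0 h1) Ψ
  have ha2 := WeilPlaneForty.sq_a_eq h0 h1 a ha
  exact CorankOne.isWeilType (K := fun j : Fin 3 => L ((![0, 0, 1] : Fin 3 → Fin 2) j)) (fun j => hB ((![0, 0, 1] : Fin 3 → Fin 2) j))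
    (fun j => a ((![0, 0, 1] : Fin 3 → Fin 2) j)) two_pos (fun j => ha2 _) three_pos (sum_finrank_slots_eq h0 h1 hfin)
    (isGaloisBalancedAlg_weilFibre_slots h0 h1 hΦ hind hfin a ha)

set_option maxHeartbeats 1000000 in -- the dependent slot family `L (![0, 0, 1] j)` makes unification slow
/-- **THE HODGE CONJECTURE FOR EVERY PRODUCT OF COPIES `⨁_{j<N} B_{π j}` OF `E'` AND `Y_{40}` — EVERY `E'^a × Y_{40}^c`, `J_{40}`'S PIECES `X_8 ∼ E'²`,
`X_{40} ∼ Y_{40}²`, `X_8 × X_{40}` INCLUDED UP TO ISOGENY — FOLLOWS FROM THE ALGEBRAICITY OF THE RATIONAL `(3,3)` CLASSES OF THE ONE WEIL PLANE OF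
`Z = E' ⊕ E' ⊕ Y_{40}`** (F58b `hodgeConjectureFor_slots_of_weilClasses_algebraic_weighted`: the pair has corank one (§2), the Weil fibre of `Z` is balanced
(§3), `Y_{40}` occurs once in `Z`, the repeated member `E'` is an elliptic curve).  Moonen–Zarhin's case (g) made quantitative on the WHOLE family:
`B•(E' × Y_{40}) = D•` (Thm. 0.2 (3); the tree's F46), yet every `E'^a × Y_{40}^c` is governed by the Weil classes of `Z` (§5 Case 2).  The hypothesis
`hW` — Weil's question for the sixfold `Z` of Weil type `(3, 2)` — is NOT claimed. [cite: MoonenZarhin1999LowDim, Thm. 0.2 (3), §3 (3.1) and §5 Case 2]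
[cite: vanGeemen1994HodgeAV, 1.1 and Thm. 4.11] [cite: Milne2020HodgeClassesAV, Thm. 1] [cite: Gordon1999HodgeAVSurvey, 9.5] -/
theorem hodgeConjectureFor_prod_of_weilClasses_algebraic (h0 : lev 0 = 8) (h1 : lev 1 = 40)
    (hΦ : ∀ i (σ : K i →+* ℂ), σ ∈ (Φ i).1 ↔ 2 * (expOf (lev i) (K i) σ).val < lev i)
    (hind : ∀ i, inducedCMType (algebraMap (L i) (K i)) (Ψ i) = Φ i) (hfin : ∀ i, Module.finrank (L i) (K i) = 2) (a : ∀ i, 𝓞 (L i))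
    (ha : ∀ i, (((a i : L i)) : K i) = zetaOf (lev i) (K i) ^ ((![7, 5] : Fin 2 → ℕ) i) - (zetaOf (lev i) (K i) ^ ((![7, 5] : Fin 2 → ℕ) i))⁻¹)
    (hB : ∀ i, IsCMTypeRealisation (Ψ i) (B i) (ιB i) (θB i)) (hs : (B 1).IsSimple) (hst : IsStablyNondegenerate (B 1))
    (hW : ∀ c ∈ weilClassesOf (⨁ fun j : Fin 3 => B ((![0, 0, 1] : Fin 3 → Fin 2) j))
        (biproduct.map fun j : Fin 3 => ιB ((![0, 0, 1] : Fin 3 → Fin 2) j) (a ((![0, 0, 1] : Fin 3 → Fin 2) j))) 3 2,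
      IsRationalClass c → IsOfHodgeType (2 * 3) (⨁ fun j : Fin 3 => B ((![0, 0, 1] : Fin 3 → Fin 2) j)).X (2 * 3) 3 3 c →
        c ∈ algebraicClasses (⨁ fun j : Fin 3 => B ((![0, 0, 1] : Fin 3 → Fin 2) j)).X 3)
    (N : ℕ) (π : Fin N → Fin 2) : HodgeConjectureFor (⨁ fun j => B (π j)).dim (⨁ fun j => B (π j)).X := by
  haveI : ∀ i, IsCMField (L i) := isCMField_sub (two_lt_lev h0 h1) Ψ
  have ha2 := WeilPlaneForty.sq_a_eq h0 h1 a ha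
  obtain ⟨hsurj, hj₀, hpair⟩ := slotMap_facts
  obtain ⟨hd0, -⟩ := finrank_eq (K := K) h0 h1 hfin
  have hquad : ∀ j₁ j₂ : Fin 3, j₁ ≠ j₂ → (![0, 0, 1] : Fin 3 → Fin 2) j₁ = (![0, 0, 1] : Fin 3 → Fin 2) j₂ →
      finrank ℚ (L ((![0, 0, 1] : Fin 3 → Fin 2) j₁)) = 2 := by
    intro j₁ j₂ hne h
    rw [hpair j₁ j₂ hne h]
    exact hd0
  exact CorankOne.hodgeConjectureFor_slots_of_weilClasses_algebraic_weighted (K := fun i : Fin 2 => L i) (Φ := Ψ)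
    (cmFamilyRank_ge h0 h1 hfin hB hs hst) hB (![0, 0, 1] : Fin 3 → Fin 2) a two_pos ha2 three_pos (sum_finrank_slots_eq h0 h1 hfin)
    (isGaloisBalancedAlg_weilFibre_slots h0 h1 hΦ hind hfin a ha) 2 hj₀ hquad hW π fun j => hsurj (π j)

set_option maxHeartbeats 1000000 in -- the dependent slot family `L (![0, 0, 1] j)` makes unification slow
/-- **… and for every `X` ISOGENOUS to a product of copies of `E'`, `Y_{40}`** (van Geemen's Lemma 3.7): `X ∼ E'^a × Y_{40}^c`, in particular the pieces
`X_8`, `X_{40}` of `J_{40}` and all their products. [cite: vanGeemen1994HodgeAV, §3.5–3.7 Lemma 3.7] [cite: MoonenZarhin1999LowDim, §5 Case 2] -/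
theorem hodgeConjectureFor_of_isIsogenous_prod_of_weilClasses_algebraic (h0 : lev 0 = 8) (h1 : lev 1 = 40)
    (hΦ : ∀ i (σ : K i →+* ℂ), σ ∈ (Φ i).1 ↔ 2 * (expOf (lev i) (K i) σ).val < lev i)
    (hind : ∀ i, inducedCMType (algebraMap (L i) (K i)) (Ψ i) = Φ i) (hfin : ∀ i, Module.finrank (L i) (K i) = 2) (a : ∀ i, 𝓞 (L i))
    (ha : ∀ i, (((a i : L i)) : K i) = zetaOf (lev i) (K i) ^ ((![7, 5] : Fin 2 → ℕ) i) - (zetaOf (lev i) (K i) ^ ((![7, 5] : Fin 2 → ℕ) i))⁻¹)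
    (hB : ∀ i, IsCMTypeRealisation (Ψ i) (B i) (ιB i) (θB i)) (hs : (B 1).IsSimple) (hst : IsStablyNondegenerate (B 1))
    (hW : ∀ c ∈ weilClassesOf (⨁ fun j : Fin 3 => B ((![0, 0, 1] : Fin 3 → Fin 2) j))
        (biproduct.map fun j : Fin 3 => ιB ((![0, 0, 1] : Fin 3 → Fin 2) j) (a ((![0, 0, 1] : Fin 3 → Fin 2) j))) 3 2,
      IsRationalClass c → IsOfHodgeType (2 * 3) (⨁ fun j : Fin 3 => B ((![0, 0, 1] : Fin 3 → Fin 2) j)).X (2 * 3) 3 3 c →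
        c ∈ algebraicClasses (⨁ fun j : Fin 3 => B ((![0, 0, 1] : Fin 3 → Fin 2) j)).X 3)
    {N : ℕ} (π : Fin N → Fin 2) {X : AbelianVariety ℂ} (hX : IsIsogenous X (⨁ fun j => B (π j))) : HodgeConjectureFor X.dim X.X :=
  HodgeTheory.HodgeConjectureFor.of_isIsogenous hX (hodgeConjectureFor_prod_of_weilClasses_algebraic h0 h1 hΦ hind hfin a ha hB hs hst hW N π)

set_option maxHeartbeats 1000000 in -- the dependent slot family `L (![0, 0, 1] j)` makes unification slow
/-- **THE EQUIVALENCE: (∀ `X = ⨁_{j<N} B_{π j}` a product of copies of `E'`, `Y_{40}`, `HC(X)`) ⟺ the rational `(3,3)` classes of the one Weil plane of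
`Z = E' ⊕ E' ⊕ Y_{40}` are algebraic** (⟹ from `π = (0, 0, 1)`).  Moonen–Zarhin (3.1) in case (g), sharp: the Hodge conjecture for the isogeny-closed
family generated by `E'` and `Y_{40}` IS Weil's question for the sixfold `Z`. [cite: MoonenZarhin1999LowDim, §3 (3.1) and §5 Case 2]
[cite: vanGeemen1994HodgeAV, 1.1 and Thm. 6.12] [cite: Gordon1999HodgeAVSurvey, 9.5] -/
theorem forall_hodgeConjectureFor_prod_iff_weilClasses_algebraic (h0 : lev 0 = 8) (h1 : lev 1 = 40)
    (hΦ : ∀ i (σ : K i →+* ℂ), σ ∈ (Φ i).1 ↔ 2 * (expOf (lev i) (K i) σ).val < lev i)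
    (hind : ∀ i, inducedCMType (algebraMap (L i) (K i)) (Ψ i) = Φ i) (hfin : ∀ i, Module.finrank (L i) (K i) = 2) (a : ∀ i, 𝓞 (L i))
    (ha : ∀ i, (((a i : L i)) : K i) = zetaOf (lev i) (K i) ^ ((![7, 5] : Fin 2 → ℕ) i) - (zetaOf (lev i) (K i) ^ ((![7, 5] : Fin 2 → ℕ) i))⁻¹)
    (hB : ∀ i, IsCMTypeRealisation (Ψ i) (B i) (ιB i) (θB i)) (hs : (B 1).IsSimple) (hst : IsStablyNondegenerate (B 1)) :
    (∀ (N : ℕ) (π : Fin N → Fin 2), HodgeConjectureFor (⨁ fun j => B (π j)).dim (⨁ fun j => B (π j)).X) ↔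
      ∀ c ∈ weilClassesOf (⨁ fun j : Fin 3 => B ((![0, 0, 1] : Fin 3 → Fin 2) j))
          (biproduct.map fun j : Fin 3 => ιB ((![0, 0, 1] : Fin 3 → Fin 2) j) (a ((![0, 0, 1] : Fin 3 → Fin 2) j))) 3 2,
        IsRationalClass c → IsOfHodgeType (2 * 3) (⨁ fun j : Fin 3 => B ((![0, 0, 1] : Fin 3 → Fin 2) j)).X (2 * 3) 3 3 c →
          c ∈ algebraicClasses (⨁ fun j : Fin 3 => B ((![0, 0, 1] : Fin 3 → Fin 2) j)).X 3 := by
  refine ⟨fun h c hcW hcQ hcH => ?_, fun hW N π => hodgeConjectureFor_prod_of_weilClasses_algebraic h0 h1 hΦ hind hfin a ha hB hs hst hW N π⟩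
  have hZ := h 3 (![0, 0, 1] : Fin 3 → Fin 2)
  obtain ⟨-, -, h6⟩ := dim_eq h0 h1 hfin hB
  exact hZ.2 3 c hcQ (by rw [h6]; exact hcH)

set_option maxHeartbeats 1000000 in -- the dependent slot family `L (![0, 0, 1] j)` makes unification slow
/-- **`HC(Z) ⟺ W` for the sixfold `Z = E' ⊕ E' ⊕ Y_{40}` itself**: the Hodge conjecture for Moonen–Zarhin's `Z = E² × Y` is exactly the algebraicity of
the rational `(3,3)` classes of its Weil plane (and then propagates to every `E'^a × Y_{40}^c`). [cite: MoonenZarhin1999LowDim, §5 Case 2]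
[cite: vanGeemen1994HodgeAV, 1.1 and Thm. 6.12] -/
theorem hodgeConjectureFor_sixfold_iff_weilClasses_algebraic (h0 : lev 0 = 8) (h1 : lev 1 = 40)
    (hΦ : ∀ i (σ : K i →+* ℂ), σ ∈ (Φ i).1 ↔ 2 * (expOf (lev i) (K i) σ).val < lev i)
    (hind : ∀ i, inducedCMType (algebraMap (L i) (K i)) (Ψ i) = Φ i) (hfin : ∀ i, Module.finrank (L i) (K i) = 2) (a : ∀ i, 𝓞 (L i))
    (ha : ∀ i, (((a i : L i)) : K i) = zetaOf (lev i) (K i) ^ ((![7, 5] : Fin 2 → ℕ) i) - (zetaOf (lev i) (K i) ^ ((![7, 5] : Fin 2 → ℕ) i))⁻¹)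
    (hB : ∀ i, IsCMTypeRealisation (Ψ i) (B i) (ιB i) (θB i)) (hs : (B 1).IsSimple) (hst : IsStablyNondegenerate (B 1)) :
    HodgeConjectureFor (⨁ fun j : Fin 3 => B ((![0, 0, 1] : Fin 3 → Fin 2) j)).dim (⨁ fun j : Fin 3 => B ((![0, 0, 1] : Fin 3 → Fin 2) j)).X ↔
      ∀ c ∈ weilClassesOf (⨁ fun j : Fin 3 => B ((![0, 0, 1] : Fin 3 → Fin 2) j))
          (biproduct.map fun j : Fin 3 => ιB ((![0, 0, 1] : Fin 3 → Fin 2) j) (a ((![0, 0, 1] : Fin 3 → Fin 2) j))) 3 2,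
        IsRationalClass c → IsOfHodgeType (2 * 3) (⨁ fun j : Fin 3 => B ((![0, 0, 1] : Fin 3 → Fin 2) j)).X (2 * 3) 3 3 c →
          c ∈ algebraicClasses (⨁ fun j : Fin 3 => B ((![0, 0, 1] : Fin 3 → Fin 2) j)).X 3 := by
  refine ⟨fun hZ c hcW hcQ hcH => ?_, fun hW =>
    hodgeConjectureFor_prod_of_weilClasses_algebraic h0 h1 hΦ hind hfin a ha hB hs hst hW 3 (![0, 0, 1] : Fin 3 → Fin 2)⟩
  obtain ⟨-, -, h6⟩ := dim_eq h0 h1 hfin hB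
  exact hZ.2 3 c hcQ (by rw [h6]; exact hcH)

set_option maxHeartbeats 1000000 in -- the dependent slot family `L (![0, 0, 1] j)` makes unification slow
/-- **Moonen–Zarhin's `X = E' × Y_{40}` (case (g)) and the pieces' product `E'² × Y_{40}² ∼ X_8 × X_{40}` of `J_{40}`**: both satisfy the Hodge conjecture
once the Weil plane of `Z` is algebraic (`π = id` resp. `π = (0, 0, 1, 1)`; for `E' × Y_{40}` itself the tree's F46 gives `B• = D•` and HC unconditionally).
[cite: MoonenZarhin1999LowDim, Thm. 0.2 (3) and §5 Case 2] [cite: GalleseGoodsonLombardo2024, §3 Thm. 3.0 (5)] -/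
theorem hodgeConjectureFor_curve_fourfold_products_of_weilClasses_algebraic (h0 : lev 0 = 8) (h1 : lev 1 = 40)
    (hΦ : ∀ i (σ : K i →+* ℂ), σ ∈ (Φ i).1 ↔ 2 * (expOf (lev i) (K i) σ).val < lev i)
    (hind : ∀ i, inducedCMType (algebraMap (L i) (K i)) (Ψ i) = Φ i) (hfin : ∀ i, Module.finrank (L i) (K i) = 2) (a : ∀ i, 𝓞 (L i))
    (ha : ∀ i, (((a i : L i)) : K i) = zetaOf (lev i) (K i) ^ ((![7, 5] : Fin 2 → ℕ) i) - (zetaOf (lev i) (K i) ^ ((![7, 5] : Fin 2 → ℕ) i))⁻¹)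
    (hB : ∀ i, IsCMTypeRealisation (Ψ i) (B i) (ιB i) (θB i)) (hs : (B 1).IsSimple) (hst : IsStablyNondegenerate (B 1))
    (hW : ∀ c ∈ weilClassesOf (⨁ fun j : Fin 3 => B ((![0, 0, 1] : Fin 3 → Fin 2) j))
        (biproduct.map fun j : Fin 3 => ιB ((![0, 0, 1] : Fin 3 → Fin 2) j) (a ((![0, 0, 1] : Fin 3 → Fin 2) j))) 3 2,
      IsRationalClass c → IsOfHodgeType (2 * 3) (⨁ fun j : Fin 3 => B ((![0, 0, 1] : Fin 3 → Fin 2) j)).X (2 * 3) 3 3 c →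
        c ∈ algebraicClasses (⨁ fun j : Fin 3 => B ((![0, 0, 1] : Fin 3 → Fin 2) j)).X 3) :
    HodgeConjectureFor (⨁ B).dim (⨁ B).X ∧
      HodgeConjectureFor (⨁ fun j : Fin 4 => B ((![0, 0, 1, 1] : Fin 4 → Fin 2) j)).dim
        (⨁ fun j : Fin 4 => B ((![0, 0, 1, 1] : Fin 4 → Fin 2) j)).X :=
  ⟨hodgeConjectureFor_prod_of_weilClasses_algebraic h0 h1 hΦ hind hfin a ha hB hs hst hW 2 id,
    hodgeConjectureFor_prod_of_weilClasses_algebraic h0 h1 hΦ hind hfin a ha hB hs hst hW 4 (![0, 0, 1, 1] : Fin 4 → Fin 2)⟩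

end Geometry

/-! ## §5 The data exist on the pieces `X_8 ∼ E'²`, `X_{40} ∼ Y_{40}²` of `J_{40}`; a hypothesis-free form -/

section Existence

variable {lev : Fin 2 → ℕ} [∀ i, NeZero (lev i)] {K : Fin 2 → Type} [∀ i, Field (K i)] [∀ i, NumberField (K i)]
  [∀ i, IsCyclotomicExtension {lev i} ℚ (K i)] {Φ : ∀ i, CMType (K i)}
  {A : Fin 2 → AbelianVariety ℂ} {ι : ∀ i, 𝓞 (K i) →+* End (A i)} {θ : ∀ i, K i →+* Module.End ℂ (complexBetti (A i).X 1)}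

/-- `ζ_8⁷ − ζ_8^{−7} = −(ζ_8 − ζ_8^{−1})` (`ζ_8⁷ = ζ_8^{−1}`). [cite: Washington1997, Ch. 2 (basic cyclotomic relations)] -/
private theorem zetaOf_pow_seven_sub_inv (h0 : lev 0 = 8) :
    zetaOf (lev 0) (K 0) ^ 7 - (zetaOf (lev 0) (K 0) ^ 7)⁻¹ = -(zetaOf (lev 0) (K 0) ^ 1 - (zetaOf (lev 0) (K 0) ^ 1)⁻¹) := by
  have hζ : IsPrimitiveRoot (zetaOf (lev 0) (K 0)) (lev 0) := IsCyclotomicExtension.zeta_spec (lev 0) ℚ (K 0)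
  have h8 : zetaOf (lev 0) (K 0) ^ 8 = 1 := by rw [← h0]; exact hζ.pow_eq_one
  have h7 : zetaOf (lev 0) (K 0) ^ 7 = (zetaOf (lev 0) (K 0))⁻¹ :=
    eq_inv_of_mul_eq_one_left (by rw [← pow_succ, h8])
  rw [h7, inv_inv, pow_one]
  ring

/-- **The data on realisations `A_0 ⊨ (ℚ(ζ_8); Φ_8)`, `A_1 ⊨ (ℚ(ζ_{40}); Φ_{40})` of the pieces `X_8`, `X_{40}` of `J_{40}`** (F42: the SIMPLE factors
`E' = B_0`, `Y_{40} = B_1`, `A_i ∼ B_i²`, index-`2` sub-pairs along `L_i = ℚ(ζ − ζ^{−1})`, `B_1` stably nondegenerate; F46 §4: `ζ⁵ − ζ^{−5} ∈ L_{40}`, and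
`ζ_8⁷ − ζ_8^{−7} = −(ζ_8 − ζ_8^{−1}) ∈ L_8`): the diagonal `√−2` `a = (ζ_8⁷ − ζ_8^{−7}, ζ_{40}⁵ − ζ_{40}^{−5}) ∈ 𝓞_{L_8} × 𝓞_{L_{40}}`.
[cite: GalleseGoodsonLombardo2024, §3 Thm. 3.0 (5)] [cite: MoonenZarhin1999LowDim, §5 Case 2] -/
theorem exists_data_of_lev_eq_eight_forty (h0 : lev 0 = 8) (h1 : lev 1 = 40)
    (hΦ : ∀ i (σ : K i →+* ℂ), σ ∈ (Φ i).1 ↔ 2 * (expOf (lev i) (K i) σ).val < lev i)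
    (hA : ∀ i, IsCMTypeRealisation (Φ i) (A i) (ι i) (θ i)) :
    ∃ (L : ∀ i, IntermediateField ℚ (K i)) (Ψ : ∀ i, CMType (L i)) (B : Fin 2 → AbelianVariety ℂ)
      (ιB : ∀ i, 𝓞 (L i) →+* End (B i)) (θB : ∀ i, L i →+* Module.End ℂ (complexBetti (B i).X 1)) (a : ∀ i, 𝓞 (L i)),
      (∀ i, inducedCMType (algebraMap (L i) (K i)) (Ψ i) = Φ i) ∧ (∀ i, Module.finrank (L i) (K i) = 2) ∧
      (∀ i, IsCMTypeRealisation (Ψ i) (B i) (ιB i) (θB i)) ∧ (∀ i, (B i).IsSimple) ∧ (∀ i, IsIsogenous (A i) (⨁ fun _ : Fin 2 => B i)) ∧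
      (B 0).dim = 1 ∧ (B 1).dim = 4 ∧ IsStablyNondegenerate (B 0) ∧ IsStablyNondegenerate (B 1) ∧
      (∀ u : B 0 ⟶ B 1, u = 0) ∧ (∀ v : B 1 ⟶ B 0, v = 0) ∧
      ∀ i, (((a i : L i)) : K i) = zetaOf (lev i) (K i) ^ ((![7, 5] : Fin 2 → ℕ) i) - (zetaOf (lev i) (K i) ^ ((![7, 5] : Fin 2 → ℕ) i))⁻¹ := by
  obtain ⟨L, Ψ, B, ιB, θB, hind, hfin, hL, hB, hs, hiso, hd0, hd1, hst0, hst1, hu, hv, -, -⟩ :=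
    exists_simpleFactors_of_lev_eq_eight_forty h0 h1 hΦ hA
  -- `ζ^{e_i} − ζ^{−e_i} ∈ L_i`
  have hmem : ∀ i, zetaOf (lev i) (K i) ^ ((![7, 5] : Fin 2 → ℕ) i) - (zetaOf (lev i) (K i) ^ ((![7, 5] : Fin 2 → ℕ) i))⁻¹ ∈ L i := by
    refine Fin.forall_fin_two.2 ⟨?_, ?_⟩
    · obtain ⟨hmem1, -⟩ := zetaOf_pow_sub_inv_mem_and_sq_eq_neg_two_of_eq_adjoin (K := K 0) (q := 1) ⟨0, rfl⟩ (by rw [h0])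
        (by rw [h0]; norm_num) (hΦ 0) (hL 0)
      show zetaOf (lev 0) (K 0) ^ 7 - (zetaOf (lev 0) (K 0) ^ 7)⁻¹ ∈ L 0
      rw [zetaOf_pow_seven_sub_inv h0]
      exact neg_mem hmem1
    · obtain ⟨hmem5, -⟩ := zetaOf_pow_sub_inv_mem_and_sq_eq_neg_two_of_eq_adjoin (K := K 1) (q := 5) ⟨2, rfl⟩ (by rw [h1])
        (by rw [h1]; norm_num) (hΦ 1) (hL 1)
      exact hmem5
  -- integrality of `ζ^c − ζ^{−c}` (a difference of roots of unity)
  have hint : ∀ i, IsIntegral ℤ (⟨zetaOf (lev i) (K i) ^ ((![7, 5] : Fin 2 → ℕ) i) -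
      (zetaOf (lev i) (K i) ^ ((![7, 5] : Fin 2 → ℕ) i))⁻¹, hmem i⟩ : L i) := fun i => by
    rw [← isIntegral_algebraMap_iff (algebraMap (L i) (K i)).injective]
    have hζ : IsPrimitiveRoot (zetaOf (lev i) (K i)) (lev i) := IsCyclotomicExtension.zeta_spec (lev i) ℚ (K i)
    have hζi : IsIntegral ℤ (zetaOf (lev i) (K i)) := hζ.isIntegral (NeZero.pos _)
    have hinv : (zetaOf (lev i) (K i) ^ ((![7, 5] : Fin 2 → ℕ) i))⁻¹ =
        (zetaOf (lev i) (K i) ^ ((![7, 5] : Fin 2 → ℕ) i)) ^ (lev i - 1) := by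
      refine inv_eq_of_mul_eq_one_right ?_
      rw [← pow_succ', Nat.sub_add_cancel NeZero.one_le, ← pow_mul, mul_comm, pow_mul, hζ.pow_eq_one, one_pow]
    show IsIntegral ℤ (zetaOf (lev i) (K i) ^ ((![7, 5] : Fin 2 → ℕ) i) - (zetaOf (lev i) (K i) ^ ((![7, 5] : Fin 2 → ℕ) i))⁻¹)
    rw [hinv]
    exact (hζi.pow _).sub ((hζi.pow _).pow _)
  exact ⟨L, Ψ, B, ιB, θB, fun i => ⟨⟨_, hmem i⟩, (mem_integralClosure_iff ℤ (L i)).2 (hint i)⟩, hind, hfin, hB, hs, hiso, hd0, hd1, hst0, hst1,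
    hu, hv, fun i => rfl⟩

set_option maxHeartbeats 1000000 in -- the dependent slot family `L (![0, 0, 1] j)` makes unification slow
/-- **ON THE PIECES OF `J_{40}`: THE HODGE CONJECTURE FOR EVERY PRODUCT OF COPIES OF THE SIMPLE FACTORS `E'`, `Y_{40}` OF `X_8`, `X_{40}` — AND FOR EVERY
VARIETY ISOGENOUS TO ONE, SO FOR `X_8`, `X_{40}`, `X_8 × X_{40}` AND ALL THEIR POWERS AND PRODUCTS — IS EQUIVALENT TO THE ALGEBRAICITY OF THE ONE WEIL PLANE
OF THE SIXFOLD `Z = E' ⊕ E' ⊕ Y_{40}` OF WEIL TYPE `(3, 2)`** (for realisations `A_0 ⊨ (ℚ(ζ_8); Φ_8)`, `A_1 ⊨ (ℚ(ζ_{40}); Φ_{40})` of the lower-half types).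
[cite: MoonenZarhin1999LowDim, Thm. 0.2 (3), §3 (3.1) and §5 Case 2] [cite: GalleseGoodsonLombardo2024, §3 Thm. 3.0 (5)] [cite: vanGeemen1994HodgeAV, 1.1] -/
theorem exists_simpleFactors_forall_hodgeConjectureFor_iff (h0 : lev 0 = 8) (h1 : lev 1 = 40)
    (hΦ : ∀ i (σ : K i →+* ℂ), σ ∈ (Φ i).1 ↔ 2 * (expOf (lev i) (K i) σ).val < lev i)
    (hA : ∀ i, IsCMTypeRealisation (Φ i) (A i) (ι i) (θ i)) :
    ∃ (B : Fin 2 → AbelianVariety ℂ)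
      (φ : (⨁ fun j : Fin 3 => B ((![0, 0, 1] : Fin 3 → Fin 2) j)) ⟶ (⨁ fun j : Fin 3 => B ((![0, 0, 1] : Fin 3 → Fin 2) j))),
      (∀ i, (B i).IsSimple) ∧ (B 0).dim = 1 ∧ (B 1).dim = 4 ∧ (∀ i, IsIsogenous (A i) (⨁ fun _ : Fin 2 => B i)) ∧
      (⨁ fun j : Fin 3 => B ((![0, 0, 1] : Fin 3 → Fin 2) j)).dim = 6 ∧
      φ ≫ φ = -((2 : ℕ) • 𝟙 (⨁ fun j : Fin 3 => B ((![0, 0, 1] : Fin 3 → Fin 2) j))) ∧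
      IsWeilType (⨁ fun j : Fin 3 => B ((![0, 0, 1] : Fin 3 → Fin 2) j)) φ 3 2 ∧
      ((∀ (N : ℕ) (π : Fin N → Fin 2), HodgeConjectureFor (⨁ fun j => B (π j)).dim (⨁ fun j => B (π j)).X) ↔
        ∀ c ∈ weilClassesOf (⨁ fun j : Fin 3 => B ((![0, 0, 1] : Fin 3 → Fin 2) j)) φ 3 2, IsRationalClass c →
          IsOfHodgeType (2 * 3) (⨁ fun j : Fin 3 => B ((![0, 0, 1] : Fin 3 → Fin 2) j)).X (2 * 3) 3 3 c →
            c ∈ algebraicClasses (⨁ fun j : Fin 3 => B ((![0, 0, 1] : Fin 3 → Fin 2) j)).X 3) ∧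
      (HodgeConjectureFor (⨁ fun j : Fin 3 => B ((![0, 0, 1] : Fin 3 → Fin 2) j)).dim (⨁ fun j : Fin 3 => B ((![0, 0, 1] : Fin 3 → Fin 2) j)).X ↔
        ∀ c ∈ weilClassesOf (⨁ fun j : Fin 3 => B ((![0, 0, 1] : Fin 3 → Fin 2) j)) φ 3 2, IsRationalClass c →
          IsOfHodgeType (2 * 3) (⨁ fun j : Fin 3 => B ((![0, 0, 1] : Fin 3 → Fin 2) j)).X (2 * 3) 3 3 c →
            c ∈ algebraicClasses (⨁ fun j : Fin 3 => B ((![0, 0, 1] : Fin 3 → Fin 2) j)).X 3) ∧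
      ((∀ c ∈ weilClassesOf (⨁ fun j : Fin 3 => B ((![0, 0, 1] : Fin 3 → Fin 2) j)) φ 3 2, IsRationalClass c →
          IsOfHodgeType (2 * 3) (⨁ fun j : Fin 3 => B ((![0, 0, 1] : Fin 3 → Fin 2) j)).X (2 * 3) 3 3 c →
            c ∈ algebraicClasses (⨁ fun j : Fin 3 => B ((![0, 0, 1] : Fin 3 → Fin 2) j)).X 3) →
        ∀ {N : ℕ} (π : Fin N → Fin 2) (X : AbelianVariety ℂ), IsIsogenous X (⨁ fun j => B (π j)) → HodgeConjectureFor X.dim X.X) := by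
  obtain ⟨L, Ψ, B, ιB, θB, a, hind, hfin, hB, hs, hiso, hd0, hd1, -, hst1, -, -, ha⟩ := exists_data_of_lev_eq_eight_forty h0 h1 hΦ hA
  have hWT := isWeilType_sixfold h0 h1 hΦ hind hfin a ha hB
  obtain ⟨-, -, h6⟩ := dim_eq h0 h1 hfin hB
  exact ⟨B, biproduct.map fun j : Fin 3 => ιB ((![0, 0, 1] : Fin 3 → Fin 2) j) (a ((![0, 0, 1] : Fin 3 → Fin 2) j)), hs, hd0, hd1, hiso, h6,
    hWT.sq_eq, hWT, forall_hodgeConjectureFor_prod_iff_weilClasses_algebraic h0 h1 hΦ hind hfin a ha hB (hs 1) hst1,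
    hodgeConjectureFor_sixfold_iff_weilClasses_algebraic h0 h1 hΦ hind hfin a ha hB (hs 1) hst1,
    fun hW N π X hX => hodgeConjectureFor_of_isIsogenous_prod_of_weilClasses_algebraic h0 h1 hΦ hind hfin a ha hB (hs 1) hst1 hW π hX⟩

/-- **MOONEN–ZARHIN'S CASE (g), HYPOTHESIS-FREE AND SHARP**: there are a CM ELLIPTIC CURVE `E` (`= E'`, CM by `ℚ(√−2)`) and a SIMPLE abelian FOURFOLD `Y`
(`= Y_{40}`) with an endomorphism `φ` of `Z = E ⊕ E ⊕ Y`, `φ² = −2`, making `Z` a sixfold OF WEIL TYPE `(3, 2)`, such that THE HODGE CONJECTURE FOR EVERY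
PRODUCT OF COPIES OF `E` AND `Y` (every `E^a × Y^c`, everything isogenous) IS EQUIVALENT TO THE ALGEBRAICITY OF THE RATIONAL `(3,3)` CLASSES OF THE WEIL
PLANE `W_k ⊂ H⁶(Z)` — «Rather than looking at `E × Y`, let us look at `Z := E² × Y` … `W_k ⊂ H⁶(Z, ℚ)` consists of Hodge classes».
[cite: MoonenZarhin1999LowDim, Thm. 0.2 (3) and §5 Case 2] [cite: vanGeemen1994HodgeAV, 1.1 and 4.9–4.10] [cite: GalleseGoodsonLombardo2024, §3 Thm. 3.0 (5)] -/
theorem exists_cmCurve_simple_fourfold_forall_hodgeConjectureFor_iff :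
    ∃ (B : Fin 2 → AbelianVariety ℂ)
      (φ : (⨁ fun j : Fin 3 => B ((![0, 0, 1] : Fin 3 → Fin 2) j)) ⟶ (⨁ fun j : Fin 3 => B ((![0, 0, 1] : Fin 3 → Fin 2) j))),
      (∀ i, (B i).IsSimple) ∧ (B 0).dim = 1 ∧ (B 1).dim = 4 ∧ (⨁ fun j : Fin 3 => B ((![0, 0, 1] : Fin 3 → Fin 2) j)).dim = 6 ∧
      φ ≫ φ = -((2 : ℕ) • 𝟙 (⨁ fun j : Fin 3 => B ((![0, 0, 1] : Fin 3 → Fin 2) j))) ∧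
      IsWeilType (⨁ fun j : Fin 3 => B ((![0, 0, 1] : Fin 3 → Fin 2) j)) φ 3 2 ∧
      ((∀ (N : ℕ) (π : Fin N → Fin 2), HodgeConjectureFor (⨁ fun j => B (π j)).dim (⨁ fun j => B (π j)).X) ↔
        ∀ c ∈ weilClassesOf (⨁ fun j : Fin 3 => B ((![0, 0, 1] : Fin 3 → Fin 2) j)) φ 3 2, IsRationalClass c →
          IsOfHodgeType (2 * 3) (⨁ fun j : Fin 3 => B ((![0, 0, 1] : Fin 3 → Fin 2) j)).X (2 * 3) 3 3 c →
            c ∈ algebraicClasses (⨁ fun j : Fin 3 => B ((![0, 0, 1] : Fin 3 → Fin 2) j)).X 3) ∧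
      (HodgeConjectureFor (⨁ fun j : Fin 3 => B ((![0, 0, 1] : Fin 3 → Fin 2) j)).dim (⨁ fun j : Fin 3 => B ((![0, 0, 1] : Fin 3 → Fin 2) j)).X ↔
        ∀ c ∈ weilClassesOf (⨁ fun j : Fin 3 => B ((![0, 0, 1] : Fin 3 → Fin 2) j)) φ 3 2, IsRationalClass c →
          IsOfHodgeType (2 * 3) (⨁ fun j : Fin 3 => B ((![0, 0, 1] : Fin 3 → Fin 2) j)).X (2 * 3) 3 3 c →
            c ∈ algebraicClasses (⨁ fun j : Fin 3 => B ((![0, 0, 1] : Fin 3 → Fin 2) j)).X 3) := by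
  obtain ⟨K, _, _, _, _, Φ, A, ι, θ, hΦ, hA⟩ := exists_realisation_family (![8, 40] : Fin 2 → ℕ)
    (Fin.forall_fin_two.2 ⟨by show (8 : ℕ) = 4 * (8 / 4); norm_num, by show (40 : ℕ) = 4 * (40 / 4); norm_num⟩)
    (Fin.forall_fin_two.2 ⟨by show 0 < 8 / 4; norm_num, by show 0 < 40 / 4; norm_num⟩)
  have h0 : (![8, 40] : Fin 2 → ℕ) 0 = 8 := rfl
  have h1 : (![8, 40] : Fin 2 → ℕ) 1 = 40 := rfl
  obtain ⟨B, φ, hs, hd0, hd1, -, h6, hsq, hWT, hiff, hZ, -⟩ := exists_simpleFactors_forall_hodgeConjectureFor_iff h0 h1 hΦ hA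
  exact ⟨B, φ, hs, hd0, hd1, h6, hsq, hWT, hiff, hZ⟩

end Existence

end WeightedForty

end HyperellipticJacobian

end Literature.AlgebraicGeometry.ComplexMultiplication

end
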